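import Literature.Geometry.Lorentzian.BogovskiiScalarDivergence
import Mathlib.Geometry.Manifold.PartitionOfUnity
import Mathlib.Analysis.Normed.Module.Connected
import HarnessLib

/-!
# Gluing smooth solutions of `div w = h`: unions, finite covers of connected sets, spherical shells

(trunk G08 = T-LORENTZ; family `gr`; namespace `Literature.Geometry.Lorentzian.MaoOhTao`.)

Galdi (*An introduction to the mathematical theory of the Navier–Stokes equations*, 2nd ed., III.3, Lemma III.3.2–III.3.4
and Theorem III.3.1/III.3.3) solves `div w = h`, `w ∈ C_c^∞(Ω)`, for `h ∈ C_c^∞(Ω)` with `∫ h = 0` on a bounded domain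
that is a finite union of sets star-shaped with respect to balls: the density is split as `h = Σ h_k`, `∫ h_k = 0`,
`supp h_k ⊆ Ω_k`, by cut-offs and a transfer of mass along a chain of overlapping cells (connectedness), and the cell
solutions (Bogovskiĭ's formula, `BogovskiiScalarDivergence.lean`) are added.  Mao–Oh–Tao (arXiv:2308.13031, proof of
Lemma 2.2) run the same recursion for their operators `S`, `T` (`BogovskiiGluing.lean`, weak form).  This file is the
classical, smooth version for the divergence equation:

* `exists_smooth_divInverse_union` — **gluing step**: smooth compactly supported solvability on two open sets with a
  common point passes to their union (normalised bump `θ` at the common point, a smooth partition of unity `χ₁ + χ₂ = 1`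
  on `tsupp h`, `h_k = h χ_k − (∫ h χ_k) θ`);
* `prop_biUnion_finset_of_isPreconnected` — **the recursion over a finite cover of a preconnected set**: a property of open
  sets that passes to unions of two overlapping open sets passes from the members of a finite open cover of a
  preconnected set `K` (each member meeting `K`) to the union of the cover (greedy chain: by preconnectedness some unused
  member always meets the union of the used ones);
* `isPreconnected_closedShell` — `{a ≤ |x| ≤ b}` (`0 < a`) is preconnected;
* `exists_smooth_divInverse_shell` — **Galdi's Theorem III.3.3 for spherical shells, smooth data**: for `0 < a` and
  `h ∈ C_c^∞(ℝ³)` with `tsupp h ⊆ {a < |x| < b}` and `∫ h = 0` there is a smooth field `w` with compact support,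
  `tsupp w^a ⊆ {a < |x| < b}`, and `Σ_a ∂ₐ w^a = h` pointwise (cover the closed shell spanned by `tsupp h` by finitely many
  small balls and glue).

Everything is proved; no definitions, no named facts.

## References

* G. P. Galdi, *An Introduction to the Mathematical Theory of the Navier–Stokes Equations. Steady-State Problems*,
  2nd ed., Springer (2011), Lemma III.3.2, Lemma III.3.4, Theorem III.3.1, Theorem III.3.3 (key `Galdi2011`).
* Y. Mao, S.-J. Oh, T. Tao, arXiv:2308.13031 (2023), proof of Lemma 2.2, p. 9 (key `MaoOhTao2023`).
-/

noncomputable section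

open scoped RealInnerProductSpace Topology ContDiff Manifold
open Filter MeasureTheory Set Metric Function

namespace Literature.Geometry.Lorentzian

namespace MaoOhTao

/-! ### The gluing step -/

section Union

/-- **A moment-free smooth piece** `h χ − (∫ h χ) θ`: smooth, compactly supported, supported in `tsupp χ ∪ tsupp θ`, of
zero mass when `∫ θ = 1`. [cite: Galdi2011, Lemma III.3.2] -/
theorem smooth_massFree_piece {h χ θ : E3 → ℝ} (hh : ContDiff ℝ ∞ h) (hhc : HasCompactSupport h)
    (hχ : ContDiff ℝ ∞ χ) (hθ : ContDiff ℝ ∞ θ) (hθc : HasCompactSupport θ) (hθ1 : ∫ x, θ x = 1) :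
    ContDiff ℝ ∞ (fun x ↦ h x * χ x - (∫ y, h y * χ y) * θ x) ∧
      HasCompactSupport (fun x ↦ h x * χ x - (∫ y, h y * χ y) * θ x) ∧
      tsupport (fun x ↦ h x * χ x - (∫ y, h y * χ y) * θ x) ⊆ tsupport χ ∪ tsupport θ ∧
      ∫ x, (h x * χ x - (∫ y, h y * χ y) * θ x) = 0 := by
  refine ⟨(hh.mul hχ).sub (contDiff_const.mul hθ), hhc.mul_right.sub hθc.mul_left, ?_, ?_⟩
  · refine closure_minimal (fun x hx ↦ ?_) ((isClosed_tsupport χ).union (isClosed_tsupport θ))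
    by_contra hx'
    rw [mem_union, not_or] at hx'
    have h1 : χ x = 0 := image_eq_zero_of_notMem_tsupport hx'.1
    have h2 : θ x = 0 := image_eq_zero_of_notMem_tsupport hx'.2
    apply hx
    simp [h1, h2]
  · have I1 : Integrable fun x ↦ h x * χ x := (hh.continuous.mul hχ.continuous).integrable_of_hasCompactSupport hhc.mul_right
    have I2 : Integrable fun x ↦ (∫ y, h y * χ y) * θ x := (hθ.continuous.integrable_of_hasCompactSupport hθc).const_mul _
    rw [integral_sub I1 I2, integral_const_mul, hθ1, mul_one, sub_self]

/-- **The gluing step** (Galdi's Lemma III.3.2 / Mao–Oh–Tao's recursion, classical form): if on each of two open sets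
`U₁, U₂` with a common point every `h ∈ C_c^∞` with `tsupp h ⊆ U_k`, `∫ h = 0` is the divergence of a smooth field
compactly supported inside `U_k`, then the same holds on `U₁ ∪ U₂`: with the normalised bump `θ` of a ball about the common
point inside `U₁ ∩ U₂` and a smooth partition of unity `χ₁ + χ₂ = 1` on `tsupp h` subordinate to `{U₁, U₂}`, split
`h = h₁ + h₂`, `h_k = h χ_k − (∫ h χ_k) θ`, and add the solutions. [cite: Galdi2011, Lemma III.3.2] -/
theorem exists_smooth_divInverse_union {U₁ U₂ : Set E3} (hU₁ : IsOpen U₁) (hU₂ : IsOpen U₂) {p : E3}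
    (hp₁ : p ∈ U₁) (hp₂ : p ∈ U₂)
    (h₁ : ∀ h : E3 → ℝ, ContDiff ℝ ∞ h → HasCompactSupport h → tsupport h ⊆ U₁ → ∫ x, h x = 0 →
      ∃ w : Fin 3 → E3 → ℝ, (∀ a, ContDiff ℝ ∞ (w a)) ∧ (∀ a, HasCompactSupport (w a)) ∧
        (∀ a, tsupport (w a) ⊆ U₁) ∧ ∀ x, ∑ a, pd a (w a) x = h x)
    (h₂ : ∀ h : E3 → ℝ, ContDiff ℝ ∞ h → HasCompactSupport h → tsupport h ⊆ U₂ → ∫ x, h x = 0 →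
      ∃ w : Fin 3 → E3 → ℝ, (∀ a, ContDiff ℝ ∞ (w a)) ∧ (∀ a, HasCompactSupport (w a)) ∧
        (∀ a, tsupport (w a) ⊆ U₂) ∧ ∀ x, ∑ a, pd a (w a) x = h x)
    (h : E3 → ℝ) (hh : ContDiff ℝ ∞ h) (hhc : HasCompactSupport h) (hhU : tsupport h ⊆ U₁ ∪ U₂)
    (hh0 : ∫ x, h x = 0) :
    ∃ w : Fin 3 → E3 → ℝ, (∀ a, ContDiff ℝ ∞ (w a)) ∧ (∀ a, HasCompactSupport (w a)) ∧
      (∀ a, tsupport (w a) ⊆ U₁ ∪ U₂) ∧ ∀ x, ∑ a, pd a (w a) x = h x := by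
  -- the normalised bump `θ` at `p`, supported in `U₁ ∩ U₂`
  obtain ⟨ε, hε, hball⟩ := Metric.isOpen_iff.1 (hU₁.inter hU₂) p ⟨hp₁, hp₂⟩
  let b : ContDiffBump p := ⟨ε / 4, ε / 2, by positivity, by linarith⟩
  set θ : E3 → ℝ := b.normed volume with hθdef
  have hθ : ContDiff ℝ ∞ θ := b.contDiff_normed
  have hθc : HasCompactSupport θ := b.hasCompactSupport_normed
  have hθ1 : ∫ x, θ x = 1 := b.integral_normed
  have hθU : tsupport θ ⊆ U₁ ∩ U₂ := by
    rw [hθdef, b.tsupport_normed_eq]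
    exact (closedBall_subset_ball (by show ε / 2 < ε; linarith)).trans hball
  -- a smooth partition of unity on `tsupp h` subordinate to `{U₁, U₂}`
  let V : Bool → Set E3 := fun c ↦ cond c U₁ U₂
  have hVo : ∀ c, IsOpen (V c) := fun c ↦ by cases c <;> assumption
  have hfV : tsupport h ⊆ ⋃ c, V c := by
    intro x hx
    rcases hhU hx with hx' | hx'
    · exact mem_iUnion.2 ⟨true, hx'⟩
    · exact mem_iUnion.2 ⟨false, hx'⟩
  obtain ⟨ρ, hρ⟩ := SmoothPartitionOfUnity.exists_isSubordinate (I := 𝓘(ℝ, E3)) (isClosed_tsupport h) V hVo hfV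
  set χ₁ : E3 → ℝ := fun x ↦ ρ true x with hχ₁def
  set χ₂ : E3 → ℝ := fun x ↦ ρ false x with hχ₂def
  have hχ₁ : ContDiff ℝ ∞ χ₁ := contMDiff_iff_contDiff.1 (ρ true).contMDiff
  have hχ₂ : ContDiff ℝ ∞ χ₂ := contMDiff_iff_contDiff.1 (ρ false).contMDiff
  have hχ₁U : tsupport χ₁ ⊆ U₁ := hρ true
  have hχ₂U : tsupport χ₂ ⊆ U₂ := hρ false
  have hsum : ∀ x, h x ≠ 0 → χ₁ x + χ₂ x = 1 := by
    intro x hx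
    have hs := ρ.sum_eq_one (subset_tsupport h (mem_support.2 hx))
    rw [finsum_eq_sum_of_fintype, Fintype.sum_bool] at hs
    exact hs
  -- the two pieces
  obtain ⟨c₁, s₁, t₁, m₁⟩ := smooth_massFree_piece hh hhc hχ₁ hθ hθc hθ1
  obtain ⟨c₂, s₂, t₂, m₂⟩ := smooth_massFree_piece hh hhc hχ₂ hθ hθc hθ1
  obtain ⟨w₁, hw₁, hw₁c, hw₁U, hw₁d⟩ := h₁ _ c₁ s₁
    (t₁.trans (union_subset hχ₁U (hθU.trans inter_subset_left))) m₁
  obtain ⟨w₂, hw₂, hw₂c, hw₂U, hw₂d⟩ := h₂ _ c₂ s₂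
    (t₂.trans (union_subset hχ₂U (hθU.trans inter_subset_right))) m₂
  refine ⟨fun a x ↦ w₁ a x + w₂ a x, fun a ↦ (hw₁ a).add (hw₂ a), fun a ↦ (hw₁c a).add (hw₂c a), fun a ↦
    (tsupport_add (w₁ a) (w₂ a)).trans (union_subset_union (hw₁U a) (hw₂U a)), fun x ↦ ?_⟩
  -- the divergence of the sum
  have hpd : ∀ a, pd a (fun x ↦ w₁ a x + w₂ a x) x = pd a (w₁ a) x + pd a (w₂ a) x := fun a ↦
    pd_add ((hw₁ a).differentiable (by simp) x) ((hw₂ a).differentiable (by simp) x)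
  simp only [hpd, Finset.sum_add_distrib, hw₁d, hw₂d]
  have hpt : ∀ y, h y * χ₁ y + h y * χ₂ y = h y := by
    intro y
    by_cases hy : h y = 0
    · simp [hy]
    · rw [← mul_add, hsum y hy, mul_one]
  have I : ∀ χ : E3 → ℝ, ContDiff ℝ ∞ χ → Integrable fun y ↦ h y * χ y := fun χ hχ ↦
    (hh.continuous.mul hχ.continuous).integrable_of_hasCompactSupport hhc.mul_right
  have hint : (∫ y, h y * χ₁ y) + ∫ y, h y * χ₂ y = 0 := by
    rw [← integral_add (I χ₁ hχ₁) (I χ₂ hχ₂), ← hh0]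
    exact integral_congr_ae (ae_of_all _ fun y ↦ hpt y)
  calc h x * χ₁ x - (∫ y, h y * χ₁ y) * θ x + (h x * χ₂ x - (∫ y, h y * χ₂ y) * θ x)
      = (h x * χ₁ x + h x * χ₂ x) - ((∫ y, h y * χ₁ y) + ∫ y, h y * χ₂ y) * θ x := by ring
    _ = h x := by rw [hpt x, hint, zero_mul, sub_zero]

end Union

/-! ### The recursion over a finite cover of a preconnected set -/

section Cover

/-- **Greedy chain recursion.** Let `P` be a property of sets that passes to the union of two open sets with a common
point.  If a preconnected set `K` is covered by finitely many open sets `V i`, `i ∈ t`, each meeting `K` and each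
satisfying `P`, then the union `⋃_{i ∈ t} V i` satisfies `P`: by preconnectedness of `K`, as long as some members are
unused one of them meets the union of the used ones ("we can always relabel the sets so that each meets the union of the
preceding ones"). [cite: Galdi2011, Lemma III.3.4] -/
theorem prop_biUnion_finset_of_isPreconnected {α ι : Type*} [TopologicalSpace α] {P : Set α → Prop}
    (hP : ∀ U₁ U₂ : Set α, IsOpen U₁ → IsOpen U₂ → (U₁ ∩ U₂).Nonempty → P U₁ → P U₂ → P (U₁ ∪ U₂))
    {K : Set α} (hK : IsPreconnected K) (t : Finset ι) (V : ι → Set α) (hVo : ∀ i ∈ t, IsOpen (V i))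
    (hVP : ∀ i ∈ t, P (V i)) (hKV : K ⊆ ⋃ i ∈ t, V i) (hmeet : ∀ i ∈ t, (V i ∩ K).Nonempty) (ht : t.Nonempty) :
    P (⋃ i ∈ t, V i) := by
  classical
  -- unions over sub-families are open
  have hUo : ∀ s : Finset ι, s ⊆ t → IsOpen (⋃ i ∈ s, V i) := fun s hs ↦
    isOpen_biUnion fun i hi ↦ hVo i (hs hi)
  suffices key : ∀ n : ℕ, ∀ s : Finset ι, s ⊆ t → s.Nonempty → (t \ s).card = n →
      P (⋃ i ∈ s, V i) → P (⋃ i ∈ t, V i) by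
    obtain ⟨i₀, hi₀⟩ := ht
    refine key _ {i₀} (Finset.singleton_subset_iff.2 hi₀) (Finset.singleton_nonempty i₀) rfl ?_
    simpa using hVP i₀ hi₀
  intro n
  induction n with
  | zero =>
    intro s hst _ hcard hPs
    have hts : t ⊆ s := Finset.sdiff_eq_empty_iff_subset.1 (Finset.card_eq_zero.1 hcard)
    rwa [Finset.Subset.antisymm hst hts] at hPs
  | succ n ih =>
    intro s hst hs hcard hPs
    -- some unused member meets the union of the used ones
    have hex : ∃ j ∈ t \ s, (V j ∩ ⋃ i ∈ s, V i).Nonempty := by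
      by_contra hcon
      push Not at hcon
      have hWo : IsOpen (⋃ j ∈ t \ s, V j) := isOpen_biUnion fun j hj ↦ hVo j (Finset.mem_sdiff.1 hj).1
      have hKUW : K ⊆ (⋃ i ∈ s, V i) ∪ ⋃ j ∈ t \ s, V j := by
        intro x hx
        obtain ⟨i, hi, hxi⟩ := mem_iUnion₂.1 (hKV hx)
        by_cases his : i ∈ s
        · exact Or.inl (mem_iUnion₂.2 ⟨i, his, hxi⟩)
        · exact Or.inr (mem_iUnion₂.2 ⟨i, Finset.mem_sdiff.2 ⟨hi, his⟩, hxi⟩)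
      have hKU : (K ∩ ⋃ i ∈ s, V i).Nonempty := by
        obtain ⟨i, hi⟩ := hs
        obtain ⟨x, hxV, hxK⟩ := hmeet i (hst hi)
        exact ⟨x, hxK, mem_iUnion₂.2 ⟨i, hi, hxV⟩⟩
      have hKW : (K ∩ ⋃ j ∈ t \ s, V j).Nonempty := by
        obtain ⟨j, hj⟩ := Finset.card_pos.1 (by omega : 0 < (t \ s).card)
        obtain ⟨x, hxV, hxK⟩ := hmeet j (Finset.mem_sdiff.1 hj).1
        exact ⟨x, hxK, mem_iUnion₂.2 ⟨j, hj, hxV⟩⟩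
      obtain ⟨x, _, hxU, hxW⟩ := hK _ _ (hUo s hst) hWo hKUW hKU hKW
      obtain ⟨j, hj, hxj⟩ := mem_iUnion₂.1 hxW
      have hx : x ∈ V j ∩ ⋃ i ∈ s, V i := ⟨hxj, hxU⟩
      rw [hcon j hj] at hx
      exact hx
    obtain ⟨j, hj, hjU⟩ := hex
    have hjt : j ∈ t := (Finset.mem_sdiff.1 hj).1
    have hPU : P ((⋃ i ∈ s, V i) ∪ V j) :=
      hP _ _ (hUo s hst) (hVo j hjt) (by rwa [inter_comm]) hPs (hVP j hjt)
    have heq : (⋃ i ∈ insert j s, V i) = (⋃ i ∈ s, V i) ∪ V j := by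
      rw [Finset.set_biUnion_insert, union_comm]
    refine ih (insert j s) (Finset.insert_subset hjt hst) (Finset.insert_nonempty j s) ?_ (heq ▸ hPU)
    rw [Finset.sdiff_insert, Finset.card_erase_of_mem hj, hcard]
    rfl

end Cover

/-! ### Spherical shells -/

section Shell

/-- **The closed shell `{a ≤ |x| ≤ b}` of `ℝ³` (`0 < a`) is preconnected**: it is the image of `sphere × [a, b]` under
`(u, r) ↦ r • u`, and the unit sphere of `ℝ³` is preconnected. [folklore] -/
theorem isPreconnected_closedShell {a b : ℝ} (ha : 0 < a) : IsPreconnected {x : E3 | a ≤ ‖x‖ ∧ ‖x‖ ≤ b} := by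
  have himage : {x : E3 | a ≤ ‖x‖ ∧ ‖x‖ ≤ b} =
      (fun p : E3 × ℝ ↦ p.2 • p.1) '' (sphere (0 : E3) 1 ×ˢ Icc a b) := by
    ext x
    simp only [mem_setOf_eq, mem_image, mem_prod, mem_sphere_zero_iff_norm, mem_Icc, Prod.exists]
    constructor
    · rintro ⟨ha', hb'⟩
      have hx0 : 0 < ‖x‖ := ha.trans_le ha'
      refine ⟨‖x‖⁻¹ • x, ‖x‖, ⟨?_, ha', hb'⟩, ?_⟩
      · rw [norm_smul, norm_inv, norm_norm, inv_mul_cancel₀ hx0.ne']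
      · rw [smul_smul, mul_inv_cancel₀ hx0.ne', one_smul]
    · rintro ⟨y, r, ⟨hy, har, hrb⟩, rfl⟩
      have hr : 0 < r := ha.trans_le har
      rw [norm_smul, Real.norm_of_nonneg hr.le, hy, mul_one]
      exact ⟨har, hrb⟩
  rw [himage]
  have hE : 1 < Module.rank ℝ E3 :=
    Module.one_lt_rank_of_one_lt_finrank (by rw [finrank_euclideanSpace_fin]; norm_num)
  exact ((isPreconnected_sphere hE 0 1).prod isPreconnected_Icc).image _
    (continuous_snd.smul continuous_fst).continuousOn

/-- **Galdi's Theorem III.3.3 for spherical shells, smooth data.** For `0 < a` and `h ∈ C_c^∞(ℝ³)` with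
`tsupp h ⊆ {a < |x| < b}` and `∫ h = 0` there is a smooth field `w` with compact support, `tsupp w^a ⊆ {a < |x| < b}`, and
`Σ_a ∂ₐ w^a = h` pointwise.  Proof: `tsupp h` lies in a closed shell `K = {a' ≤ |x| ≤ b'}`, `a < a' ≤ b' < b`; cover the
compact preconnected `K` by finitely many balls of radius `min (a' − a) (b − b')` centred in `K` (they lie in the open
shell and are convex, `exists_smooth_divInverse_of_convex`) and glue along the cover
(`prop_biUnion_finset_of_isPreconnected`, `exists_smooth_divInverse_union`). [cite: Galdi2011, Theorem III.3.3] -/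
theorem exists_smooth_divInverse_shell {a b : ℝ} (ha : 0 < a) (h : E3 → ℝ) (hh : ContDiff ℝ ∞ h)
    (hhc : HasCompactSupport h) (hhU : tsupport h ⊆ {x : E3 | a < ‖x‖ ∧ ‖x‖ < b}) (hh0 : ∫ x, h x = 0) :
    ∃ w : Fin 3 → E3 → ℝ, (∀ i, ContDiff ℝ ∞ (w i)) ∧ (∀ i, HasCompactSupport (w i)) ∧
      (∀ i, tsupport (w i) ⊆ {x : E3 | a < ‖x‖ ∧ ‖x‖ < b}) ∧ ∀ x, ∑ i, pd i (w i) x = h x := by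
  by_cases hne : (tsupport h).Nonempty
  swap
  · -- `h = 0`
    have h0 : h = 0 := tsupport_eq_empty_iff.1 (not_nonempty_iff_eq_empty.1 hne)
    have ht0 : tsupport (fun _ : E3 ↦ (0 : ℝ)) = ∅ := tsupport_eq_empty_iff.2 rfl
    refine ⟨fun _ _ ↦ 0, fun _ ↦ contDiff_const, fun _ ↦ HasCompactSupport.zero, fun i ↦ ?_, fun x ↦ ?_⟩
    · rw [ht0]
      exact empty_subset _
    · simp [pd, h0]
  -- the closed shell `K` spanned by `tsupp h`
  obtain ⟨x₁, hx₁, hmin⟩ := hhc.exists_isMinOn hne continuous_norm.continuousOn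
  obtain ⟨x₂, hx₂, hmax⟩ := hhc.exists_isMaxOn hne continuous_norm.continuousOn
  set a' : ℝ := ‖x₁‖ with ha'def
  set b' : ℝ := ‖x₂‖ with hb'def
  have haa' : a < a' := (hhU hx₁).1
  have hb'b : b' < b := (hhU hx₂).2
  have ha' : 0 < a' := ha.trans haa'
  set K : Set E3 := {x | a' ≤ ‖x‖ ∧ ‖x‖ ≤ b'} with hKdef
  have hhK : tsupport h ⊆ K := fun x hx ↦ ⟨hmin hx, hmax hx⟩
  have hx₁K : x₁ ∈ K := hhK hx₁
  have hKc : IsCompact K := (isCompact_closedBall (0 : E3) b').of_isClosed_subset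
    ((isClosed_le continuous_const continuous_norm).inter (isClosed_le continuous_norm continuous_const))
    fun _ hx ↦ mem_closedBall_zero_iff.2 hx.2
  have hKconn : IsPreconnected K := isPreconnected_closedShell ha'
  -- the balls
  set δ : ℝ := min (a' - a) (b - b') with hδdef
  have hδ : 0 < δ := lt_min (by linarith) (by linarith)
  have hballU : ∀ q ∈ K, ball q δ ⊆ {x : E3 | a < ‖x‖ ∧ ‖x‖ < b} := by
    intro q hq y hy
    rw [mem_ball, dist_eq_norm] at hy
    have h1 : ‖q‖ ≤ ‖y‖ + ‖y - q‖ := by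
      have := norm_add_le y (q - y)
      rwa [add_sub_cancel, ← norm_neg (q - y), neg_sub] at this
    have h2 : ‖y‖ ≤ ‖q‖ + ‖y - q‖ := norm_le_insert' y q
    have hδ1 : δ ≤ a' - a := min_le_left _ _
    have hδ2 : δ ≤ b - b' := min_le_right _ _
    exact ⟨by linarith [hq.1], by linarith [hq.2]⟩
  obtain ⟨t, ht⟩ := hKc.elim_finite_subcover (fun q : K ↦ ball (q : E3) δ) (fun _ ↦ isOpen_ball)
    fun x hx ↦ mem_iUnion.2 ⟨⟨x, hx⟩, mem_ball_self hδ⟩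
  -- glue along the cover
  have hcover := prop_biUnion_finset_of_isPreconnected
    (P := fun U : Set E3 ↦ ∀ g : E3 → ℝ, ContDiff ℝ ∞ g → HasCompactSupport g → tsupport g ⊆ U → ∫ x, g x = 0 →
      ∃ w : Fin 3 → E3 → ℝ, (∀ i, ContDiff ℝ ∞ (w i)) ∧ (∀ i, HasCompactSupport (w i)) ∧
        (∀ i, tsupport (w i) ⊆ U) ∧ ∀ x, ∑ i, pd i (w i) x = g x)
    (fun U₁ U₂ hU₁ hU₂ hne' hP₁ hP₂ ↦ by
      obtain ⟨p, hp₁, hp₂⟩ := hne'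
      exact exists_smooth_divInverse_union hU₁ hU₂ hp₁ hp₂ hP₁ hP₂)
    hKconn t (fun q : K ↦ ball (q : E3) δ) (fun q _ ↦ isOpen_ball)
    (fun q _ ↦ exists_smooth_divInverse_of_convex isOpen_ball (convex_ball _ _) ⟨q, mem_ball_self hδ⟩) ht
    (fun q _ ↦ ⟨q, mem_ball_self hδ, q.2⟩)
    (by
      obtain ⟨q, hq, _⟩ := mem_iUnion₂.1 (ht hx₁K)
      exact ⟨q, hq⟩)
  obtain ⟨w, hw, hwc, hwU, hwd⟩ := hcover h hh hhc (hhK.trans ht) hh0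
  exact ⟨w, hw, hwc, fun i ↦ (hwU i).trans (iUnion₂_subset fun q _ ↦ hballU q q.2), hwd⟩

end Shell

end MaoOhTao

end Literature.Geometry.Lorentzian

end
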